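import Mathlib.NumberTheory.ModularForms.LevelOne.GradedRing
import Mathlib.NumberTheory.ModularForms.EisensteinSeries.QExpansion
import Mathlib.NumberTheory.LSeries.HurwitzZetaValues
import Literature.NumberTheory.EllipticCurves.RealLatticePeriod
import HarnessLib

/-!
# Proof of the Uniformization Theorem (existence half, Silverman AEC VI.5.1)

Discharge `PeriodPair.uniformization_holds` of the named fact `PeriodPair.uniformization` of
`Literature/NumberTheory/EllipticCurves/Uniformization.lean` (D-0014 sibling `…Proofs` file):
for `A, B ∈ ℂ` with `A³ − 27B² ≠ 0` there is a period pair `L` (Mathlib `PeriodPair`) with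
`g₂(L) = A`, `g₃(L) = B`.

Silverman (AEC VI.5.1, C.12.11) defers the proof to the theory of modular functions; we follow
Serre, *A Course in Arithmetic*, VII §2.3 and §3.3 Prop. 5, on top of Mathlib's level-one theory
(`ModularForm.E₄`, `E₆`, `ModularForm.discriminant` with `discriminant_ne_zero`,
`discriminant_eq_E₄_cube_sub_E₆_sq : Δ = (E₄³ − E₆²)/1728`, `discriminant_isZeroAtImInfty`,
`tsum_eisSummand_eq_riemannZeta_mul_eisensteinSeries`, and
`ModularFormClass.levelOne_neg_weight_eq_zero`):

1. `PeriodPair.ofUpperHalfPlane τ = (τ, 1)`; its Eisenstein series are the full lattice sums,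
   `G_k(Λ_τ) = 2ζ(k) E_k(τ)` (`G_ofUpperHalfPlane_eq`), so with `ζ(4) = π⁴/90` (Mathlib) and
   `ζ(6) = π⁶/945` (`riemannZeta_six`, from `B₆ = 1/42`): `g₂(Λ_τ) = (4π⁴/3)E₄(τ)`,
   `g₃(Λ_τ) = (8π⁶/27)E₆(τ)`, `g₂³ − 27g₃² = (2π)¹²Δ(τ) ≠ 0` (Serre VII (42)).
2. Surjectivity of `j = 1728g₂³/Δ` (Serre VII §3.3 Prop. 5(c)) in the form
   `ModularForm.exists_E₄_cube_eq_mul_discriminant : ∀ c, ∃ τ, E₄(τ)³ = c·Δ(τ)`.  Instead of the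
   valence formula we argue: if `E₄³ − cΔ` had no zero, its inverse would be a holomorphic
   level-one modular form of weight `−12` (bounded at `i∞`, where it tends to `1`), hence `0`.
3. Homotheties `PeriodPair.mulLeft c L = (cω₁, cω₂)`: `g₂(cΛ) = c⁻⁴g₂(Λ)`, `g₃(cΛ) = c⁻⁶g₃(Λ)`
   (Silverman AEC, proof of Cor. VI.5.1.1); choosing `τ` with `j(Λ_τ) = j(A, B)` and then `c`
   with `c⁴ = g₂/A`, `c⁶ = g₃/B` (cases `A = 0`, `B = 0`, generic) gives `uniformization_holds`.

The constructions `PeriodPair.ofUpperHalfPlane`, `PeriodPair.mulLeft` (with `g₂_mulLeft`,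
`g₃_mulLeft`) live in `Literature/…/RealLatticePeriod.lean`; this file only holds proofs.

## References

* J. H. Silverman, *The Arithmetic of Elliptic Curves*, 2nd ed., GTM 106, Springer 2009,
  Thm. VI.5.1, Cor. VI.5.1.1, C.12.11.
* J.-P. Serre, *A Course in Arithmetic*, GTM 7, Springer 1973, Ch. VII, §2.3, §3.3 Prop. 5,
  §4.1–4.4 (eq. (42)).
-/

noncomputable section

open scoped Real Topology Manifold
open UpperHalfPlane ModularForm EisensteinSeries MatrixGroups Filter Complex

namespace PeriodPair

/-! ### The Eisenstein series of `Λ_τ` and the modular forms `E₄`, `E₆` -/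

/-- `G_k(Λ_τ) = ∑_{(m,n) ≠ 0} (mτ + n)^{-k}` is the full (non-normalised) Eisenstein series.
[folklore] -/
theorem G_ofUpperHalfPlane (τ : ℍ) (k : ℕ) :
    (ofUpperHalfPlane τ).G k = ∑' v : Fin 2 → ℤ, eisSummand k v τ := by
  simp only [G]
  rw [← (finTwoArrowEquivLattice τ).tsum_eq]
  congr with v
  rw [coe_finTwoArrowEquivLattice, eisSummand, zpow_neg, zpow_natCast]

/-- `G_k(Λ_τ) = 2 ζ(k) E_k(τ)` for even `k ≥ 4`, `E_k` the normalised Eisenstein series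
(Serre VII §4.1; Silverman AEC C.12). [folklore] -/
theorem G_ofUpperHalfPlane_eq {k : ℕ} (hk : 3 ≤ k) (τ : ℍ) :
    (ofUpperHalfPlane τ).G k = 2 * riemannZeta k * E hk τ := by
  rw [G_ofUpperHalfPlane, tsum_eisSummand_eq_riemannZeta_mul_eisensteinSeries hk,
    show E hk τ = (1 / 2 : ℂ) • eisensteinSeriesSIF (N := 1) 0 k τ from rfl,
    eisensteinSeriesSIF_apply]
  simp only [smul_eq_mul]
  ring

/-- `B₅' = 0`. [folklore] -/
lemma bernoulli'_five : bernoulli' 5 = 0 := by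
  have h1 : Nat.choose 5 2 = 10 := by decide
  have h2 : Nat.choose 5 3 = 10 := by decide
  rw [bernoulli'_def]
  norm_num [Finset.sum_range_succ, Finset.sum_range_zero, h1, h2]

/-- `B₆ = 1/42`. [folklore] -/
lemma bernoulli'_six : bernoulli' 6 = 1 / 42 := by
  have h1 : Nat.choose 6 2 = 15 := by decide
  have h2 : Nat.choose 6 3 = 20 := by decide
  have h3 : Nat.choose 6 4 = 15 := by decide
  rw [bernoulli'_def]
  norm_num [Finset.sum_range_succ, Finset.sum_range_zero, h1, h2, h3, bernoulli'_five]

/-- `ζ(6) = π⁶/945` (Euler). [folklore] -/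
theorem riemannZeta_six : riemannZeta 6 = (π : ℂ) ^ 6 / 945 := by
  have h := riemannZeta_two_mul_nat (k := 3) (by norm_num)
  have hb : bernoulli 6 = 1 / 42 := by
    rw [bernoulli_eq_bernoulli'_of_ne_one (by norm_num), bernoulli'_six]
  norm_num [hb, Nat.factorial] at h
  rw [h]
  ring

/-- `g₂(Λ_τ) = (4π⁴/3) E₄(τ)` (Serre VII §4.1, Silverman AEC C.12 / ATAEC I.7). [folklore] -/
theorem g₂_ofUpperHalfPlane (τ : ℍ) :
    (ofUpperHalfPlane τ).g₂ = (4 * (π : ℂ) ^ 4 / 3) * E₄ τ := by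
  rw [g₂, G_ofUpperHalfPlane_eq (by norm_num : 3 ≤ 4)]
  rw [show ((4 : ℕ) : ℂ) = 4 by norm_num, riemannZeta_four]
  ring

/-- `g₃(Λ_τ) = (8π⁶/27) E₆(τ)` (Serre VII §4.1, Silverman AEC C.12 / ATAEC I.7). [folklore] -/
theorem g₃_ofUpperHalfPlane (τ : ℍ) :
    (ofUpperHalfPlane τ).g₃ = (8 * (π : ℂ) ^ 6 / 27) * E₆ τ := by
  rw [g₃, G_ofUpperHalfPlane_eq (by norm_num : 3 ≤ 6)]
  rw [show ((6 : ℕ) : ℂ) = 6 by norm_num, riemannZeta_six]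
  ring

/-- `Δ(Λ_τ) = g₂³ − 27g₃² = (2π)¹² Δ(τ)` with `Δ(τ) = η(τ)²⁴ = (E₄³ − E₆²)/1728`
(Serre VII §4.4; Silverman AEC C.12). [folklore] -/
theorem discr_ofUpperHalfPlane (τ : ℍ) :
    (ofUpperHalfPlane τ).g₂ ^ 3 - 27 * (ofUpperHalfPlane τ).g₃ ^ 2 =
      (2 * (π : ℂ)) ^ 12 * ModularForm.discriminant τ := by
  rw [g₂_ofUpperHalfPlane, g₃_ofUpperHalfPlane, discriminant_eq_E₄_cube_sub_E₆_sq]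
  ring

end PeriodPair

/-! ### Surjectivity of the modular invariant: `E₄³ − c Δ` has a zero -/

namespace ModularForm

open SlashInvariantForm ModularFormClass CongruenceSubgroup

/-- A level-one modular form tends to the constant coefficient of its `q`-expansion at `i∞`.
[folklore] -/
theorem levelOne_tendsto_atImInfty {k : ℤ} (f : ModularForm 𝒮ℒ k) :
    Tendsto f atImInfty (𝓝 ((qExpansion 1 f).coeff 0)) := by
  have hper := SlashInvariantFormClass.periodic_comp_ofComplex f one_mem_strictPeriods_SL
  have hana := ModularFormClass.analyticAt_cuspFunction_zero f one_pos one_mem_strictPeriods_SL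
  have heq : (cuspFunction 1 f ∘ fun τ : ℍ ↦ Function.Periodic.qParam 1 τ) = f :=
    funext fun τ ↦ UpperHalfPlane.eq_cuspFunction τ one_ne_zero hper
  have h := hana.continuousAt.tendsto.comp (qParam_tendsto_atImInfty one_pos)
  rw [heq] at h
  simpa [qExpansion_coeff] using h

/-- `E_k(τ) → 1` as `im τ → ∞`. [folklore] -/
theorem tendsto_E_atImInfty {k : ℕ} (hk : 3 ≤ k) (hk2 : Even k) :
    Tendsto (E hk) atImInfty (𝓝 1) := by
  simpa [EisensteinSeries.E_qExpansion_coeff_zero hk hk2] using levelOne_tendsto_atImInfty (E hk)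

/-- **Surjectivity of `j`** in the form: for every `c ∈ ℂ` the weight-12 form `E₄³ − cΔ` has a
zero in `ℍ` (so `j = E₄³/Δ` takes the value `c`).  Proof: otherwise `1/(E₄³ − cΔ)` is a
holomorphic modular form of weight `−12` and level one, bounded at `i∞` (it tends to `1`), hence
zero (Mathlib `ModularFormClass.levelOne_neg_weight_eq_zero`) — absurd.
(Serre, *A Course in Arithmetic*, VII §3.3 Prop. 5(c); Silverman AEC C.12.11(b) / ATAEC I.4.3.)
[cite: Serre1973, VII §3.3 Prop. 5(c)] -/
theorem exists_E₄_cube_eq_mul_discriminant (c : ℂ) :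
    ∃ τ : ℍ, E₄ τ ^ 3 = c * ModularForm.discriminant τ := by
  by_contra! hne
  -- the weight-12 level-one modular form `f = E₄³ − c·Δ`
  set f : ModularForm 𝒮ℒ 12 :=
    ModularForm.mcast (by decide) (E₄.pow 3) -
      c • ModularFormClass.modularForm CuspForm.discriminant
    with hf
  have hf_apply : ∀ τ : ℍ, f τ = E₄ τ ^ 3 - c * ModularForm.discriminant τ := fun τ ↦ by
    simp only [hf, sub_apply, coe_mcast, ModularForm.coe_pow, Pi.pow_apply]
    simp
  have hf0 : ∀ τ : ℍ, f τ ≠ 0 := fun τ ↦ by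
    rw [hf_apply]; exact sub_ne_zero.mpr (hne τ)
  -- transformation law of `f`
  have hinvt : ∀ (γ : SL(2, ℤ)) (τ : ℍ), f (γ • τ) = denom γ τ ^ (12 : ℤ) * f τ := fun γ τ ↦ by
    have : SlashInvariantFormClass (ModularForm 𝒮ℒ 12) Γ(1) 12 := by
      rw [Gamma_one_coe_eq_SL]; infer_instance
    exact slash_action_eqn_SL'' f (mem_Gamma_one γ) τ
  -- the inverse `g = 1/f`
  set g : ℍ → ℂ := fun τ ↦ (f τ)⁻¹ with hg
  have hslash : ∀ γ : SL(2, ℤ), g ∣[(-12 : ℤ)] γ = g := fun γ ↦ by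
    ext τ
    rw [SL_slash_apply, hg]
    simp only [neg_neg]
    rw [hinvt γ τ, mul_inv, mul_assoc, ← zpow_neg, mul_left_comm, ← zpow_add₀ (denom_ne_zero γ τ)]
    norm_num
  have hmd : MDiff g := by
    rw [UpperHalfPlane.mdifferentiable_iff]
    have hfd : DifferentiableOn ℂ (f ∘ ofComplex) {z | 0 < z.im} :=
      UpperHalfPlane.mdifferentiable_iff.mp f.holo'
    exact hfd.inv fun z _ ↦ hf0 _
  have hbdd : IsBoundedAtImInfty g := by
    have h1 : Tendsto (fun τ : ℍ ↦ E₄ τ) atImInfty (𝓝 1) :=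
      tendsto_E_atImInfty (by norm_num) ⟨2, rfl⟩
    have h2 : Tendsto ModularForm.discriminant atImInfty (𝓝 0) := discriminant_isZeroAtImInfty
    have h3 : Tendsto (fun τ ↦ f τ) atImInfty (𝓝 1) := by
      have := (h1.pow 3).sub (h2.const_mul c)
      simp only [one_pow, mul_zero, sub_zero] at this
      exact this.congr' (Eventually.of_forall fun τ ↦ (hf_apply τ).symm)
    exact (h3.inv₀ one_ne_zero).isBigO_one ℝ
  let G : ModularForm 𝒮ℒ (-12) :=
    { toFun := g
      slash_action_eq' := fun A hA ↦ by
        obtain ⟨A, rfl⟩ := hA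
        exact hslash A
      holo' := hmd
      bdd_at_cusps' := fun {c'} hc ↦ by
        rw [OnePoint.isBoundedAt_iff_forall_SL2Z hc]
        intro γ _
        rw [hslash γ]
        exact hbdd }
  have hG : ⇑G = 0 := ModularFormClass.levelOne_neg_weight_eq_zero (by norm_num) G
  have := congr_fun hG UpperHalfPlane.I
  exact hf0 _ (inv_eq_zero.mp this)

end ModularForm

/-! ### The Uniformization Theorem, existence -/

namespace PeriodPair

/-- For `(A, B)` with `A³ − 27B² ≠ 0` there is `τ ∈ ℍ` whose lattice `Λ_τ` has "the same `j`":
`g₂(Λ_τ)³ · (A³ − 27B²) = A³ · (g₂(Λ_τ)³ − 27g₃(Λ_τ)²)` (surjectivity of `j`, Silverman AEC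
C.12.11(b) / ATAEC I.4.3). [folklore] -/
theorem exists_ofUpperHalfPlane_sameJ (A B : ℂ) (hD : A ^ 3 - 27 * B ^ 2 ≠ 0) :
    ∃ τ : ℍ, (ofUpperHalfPlane τ).g₂ ^ 3 * (A ^ 3 - 27 * B ^ 2) =
      A ^ 3 * ((ofUpperHalfPlane τ).g₂ ^ 3 - 27 * (ofUpperHalfPlane τ).g₃ ^ 2) := by
  obtain ⟨τ, hτ⟩ :=
    ModularForm.exists_E₄_cube_eq_mul_discriminant (1728 * A ^ 3 / (A ^ 3 - 27 * B ^ 2))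
  refine ⟨τ, ?_⟩
  rw [discr_ofUpperHalfPlane, g₂_ofUpperHalfPlane, mul_pow, hτ]
  field_simp
  ring

/-- `Δ(Λ_τ) = g₂³ − 27g₃² ≠ 0` (Serre VII §4.4 / Mathlib `discriminant_ne_zero`). [folklore] -/
theorem discr_ofUpperHalfPlane_ne_zero (τ : ℍ) :
    (ofUpperHalfPlane τ).g₂ ^ 3 - 27 * (ofUpperHalfPlane τ).g₃ ^ 2 ≠ 0 := by
  rw [discr_ofUpperHalfPlane]
  exact mul_ne_zero (pow_ne_zero _ (mul_ne_zero two_ne_zero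
    (Complex.ofReal_ne_zero.mpr Real.pi_ne_zero))) (ModularForm.discriminant_ne_zero τ)

/-- `n`-th roots in `ℂ` (via the principal branch of `z ↦ z^{1/n}`). [folklore] -/
lemma exists_pow_nat_eq' (x : ℂ) {n : ℕ} (hn : n ≠ 0) : ∃ c : ℂ, c ^ n = x :=
  ⟨x ^ (n⁻¹ : ℂ), Complex.cpow_nat_inv_pow x hn⟩

/-- **The Uniformization Theorem, existence** (Silverman AEC VI.5.1): discharge of the named fact
`PeriodPair.uniformization`.  Proof: by the surjectivity of `j`
(`exists_E₄_cube_eq_mul_discriminant`,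
via Mathlib's level-one theory: `E₄`, `E₆`, `Δ = (E₄³ − E₆²)/1728 ≠ 0`, and "weight `< 0` level-one
forms vanish") there is `τ` with `j(Λ_τ) = j(A, B)`, where `g₂(Λ_τ) = (4π⁴/3)E₄(τ)`,
`g₃(Λ_τ) = (8π⁶/27)E₆(τ)` (`ζ(4) = π⁴/90`, `ζ(6) = π⁶/945`); then a homothety `Λ = cΛ_τ`
(`g₂(cΛ) = c⁻⁴g₂`, `g₃(cΛ) = c⁻⁶g₃`) adjusts `(g₂, g₃)` to `(A, B)` exactly (Silverman AEC, proof of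
Cor. VI.5.1.1; Serre VII §2 Prop. 5).
[cite: SilvermanAEC2009, Thm VI.5.1 (existence); Serre1973, VII §2.3 and §3.3 Prop. 5] -/
theorem uniformization_holds : uniformization := by
  intro A B hD
  obtain ⟨τ, hτ⟩ := exists_ofUpperHalfPlane_sameJ A B hD
  set L := ofUpperHalfPlane τ with hL
  have hΔ : L.g₂ ^ 3 - 27 * L.g₃ ^ 2 ≠ 0 := discr_ofUpperHalfPlane_ne_zero τ
  by_cases hA : A = 0
  · -- `A = 0`: then `g₂ = 0`, `B ≠ 0`, `g₃ ≠ 0`; take `c⁶ = g₃/B`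
    have hg₂ : L.g₂ = 0 := by
      have h0 : L.g₂ ^ 3 * (A ^ 3 - 27 * B ^ 2) = 0 := by rw [hτ, hA]; ring
      exact (pow_eq_zero_iff (n := 3) (by norm_num)).mp ((mul_eq_zero.mp h0).resolve_right hD)
    have hB : B ≠ 0 := by rintro rfl; apply hD; rw [hA]; ring
    have hg₃ : L.g₃ ≠ 0 := by intro h0; apply hΔ; rw [hg₂, h0]; ring
    obtain ⟨c, hc⟩ := exists_pow_nat_eq' (L.g₃ / B) (by norm_num : 6 ≠ 0)
    have hc0 : c ≠ 0 := by
      rintro rfl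
      rw [zero_pow (by norm_num), eq_comm, div_eq_zero_iff] at hc
      exact hc.elim hg₃ hB
    refine ⟨L.mulLeft c hc0, ?_, ?_⟩
    · rw [g₂_mulLeft, hg₂, hA, mul_zero]
    · rw [g₃_mulLeft, hc]; field_simp
  · have key : L.g₂ ^ 3 * B ^ 2 = A ^ 3 * L.g₃ ^ 2 := by linear_combination (-1 / 27 : ℂ) * hτ
    have hg₂ : L.g₂ ≠ 0 := by
      intro h0
      have h1 : A ^ 3 * L.g₃ ^ 2 = 0 := by rw [← key, h0]; ring
      have h2 : L.g₃ = 0 := by simpa [hA] using h1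
      apply hΔ; rw [h0, h2]; ring
    by_cases hB : B = 0
    · -- `B = 0`: then `g₃ = 0`; take `c⁴ = g₂/A`
      have hg₃ : L.g₃ = 0 := by
        have h1 : A ^ 3 * L.g₃ ^ 2 = 0 := by rw [← key, hB]; ring
        simpa [hA] using h1
      obtain ⟨c, hc⟩ := exists_pow_nat_eq' (L.g₂ / A) (by norm_num : 4 ≠ 0)
      have hc0 : c ≠ 0 := by
        rintro rfl
        rw [zero_pow (by norm_num), eq_comm, div_eq_zero_iff] at hc
        exact hc.elim hg₂ hA
      refine ⟨L.mulLeft c hc0, ?_, ?_⟩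
      · rw [g₂_mulLeft, hc]; field_simp
      · rw [g₃_mulLeft, hg₃, hB, mul_zero]
    · -- generic case: `μ = (g₃/B)/(g₂/A)` has `μ² = g₂/A`, `μ³ = g₃/B`; take `c² = μ`
      have hg₃ : L.g₃ ≠ 0 := by
        intro h0
        have h1 : L.g₂ ^ 3 * B ^ 2 = 0 := by rw [key, h0]; ring
        rcases mul_eq_zero.mp h1 with h | h
        · exact hg₂ ((pow_eq_zero_iff (n := 3) (by norm_num)).mp h)
        · exact hB ((pow_eq_zero_iff (n := 2) (by norm_num)).mp h)
      set μ : ℂ := (A * L.g₃) / (B * L.g₂) with hμ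
      have hμ2 : μ ^ 2 = L.g₂ / A := by
        rw [hμ, div_pow, div_eq_div_iff (pow_ne_zero _ (mul_ne_zero hB hg₂)) hA]
        linear_combination -key
      have hμ3 : μ ^ 3 = L.g₃ / B := by
        rw [hμ, div_pow, div_eq_div_iff (pow_ne_zero _ (mul_ne_zero hB hg₂)) hB]
        linear_combination (-(B * L.g₃)) * key
      obtain ⟨c, hc⟩ := exists_pow_nat_eq' μ (by norm_num : 2 ≠ 0)
      have hμ0 : μ ≠ 0 := by
        rw [hμ]; exact div_ne_zero (mul_ne_zero hA hg₃) (mul_ne_zero hB hg₂)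
      have hc0 : c ≠ 0 := by rintro rfl; rw [zero_pow two_ne_zero] at hc; exact hμ0 hc.symm
      refine ⟨L.mulLeft c hc0, ?_, ?_⟩
      · rw [g₂_mulLeft, show c ^ 4 = μ ^ 2 by rw [← hc]; ring, hμ2]; field_simp
      · rw [g₃_mulLeft, show c ^ 6 = μ ^ 3 by rw [← hc]; ring, hμ3]; field_simp

end PeriodPair

end
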